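import Literature.AnabelianGeometry.EtaleTheta.ThetaKummerInversionFixedPoints
import Literature.AnabelianGeometry.EtaleTheta.Discharge.Sec1DeckNegatesCoordModelTate
import Literature.AnabelianGeometry.EtaleTheta.Discharge.Sec1Thm110ModelTateInversionNV
import HarnessLib

/-!
# NO `b`-axis lift `Ad(b^s) ∘ ι` of the STAGE-2 inversion carries the FUNCTION-level [EtTh] Prop 1.4 (ii) package
# at the Tate instance `modelχq p 1 2` (the model where Prop. 1.5 (iii) holds) — stage-2 twin of
# `ThetaKummerInversionBTwistNoGo` (proof-only)

S. Mochizuki, *The étale theta function …*, Publ. RIMS **45** (2009) [EtTh]: Prop 1.4 (ii) p. 22 («`Θ̈(Ü) = −Θ̈(Ü⁻¹)`»),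
Def 1.9 p. 29 (`τ`, `τ⁻¹`), §2 p. 36 (the inversion `ι`). Classical here. [cite: MochizukiEtTh2009, Prop 1.4 (ii) p.22]

abc-iut cell, layer L2, seat abc-iut-w5-d140 (gen 4), K2 holder; self-named PROOF-ONLY row «no `b`-axis lift of `ι`
carries the function-level package @ STAGE 2» (NO definition, NO instance, NO `Prop` fact; D-0067). INPUTS, ALL BY NAME:
abc-iut-w5-d125's GENERIC no-go **`KummerCore.not_exists_package_of_constCompat_of_fixed`** (p448036) at the stage-2
Kummer core `kummerCoreχq p 1 2` (abc-iut-w5-d171); abc-iut-w5-d249 / abc-iut-L2-d1's stage-2 inversion `inversionχq`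
with abc-iut-w5-d171's `inversionχq_left_tate` (the inversion defect VANISHES on the Tate pair `(i, j) = (1, 2)`),
**`exists_inversionχq_sectionOfUnitχq_conj`** (p448627: `ι(s_{√−1}(σ)) = b^{2c₀}·s_{(√−1)⁻¹}(σ)·b^{−2c₀}`),
`inr_map_GKdd_le_GtpYdd_tate`, `map_sectionOfUnitχq_GKdd_le_GtpYdd`; this seat's stage-2 odd deck element
**`exists_odd_deck_sectionOfUnitχq`** (p449236). Nothing restated.

RESULTS (`ι := inversionχq p 1 2`, `b^s := inl (bPowGfp s)`, `K̈ = K₂ = ℚ_p` at the Tate instance):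
* `exists_odd_bTwist_inversionχq_fix_sectionOfUnitχq` (`p ≡ 1 (mod 4)`): an ODD `s₀` with
  `b^{s₀}·ι(s_{√−1}(σ))·b^{−s₀} = s_{√−1}(σ)` for all `σ` — the deck-corrected odd lift fixes the stage-2 Def. 1.9 section
  of `τ` POINTWISE;
* `not_exists_package_modelχq_evenBTwist_of_constCompat` (every even `s = m²`: fixed `Ad(b^m)(inr G_K̈) ≤ Π^tp_Ÿ`),
  `not_exists_package_modelχq_oddBTwist_of_constCompat` (`p ≡ 1 (4)`, every odd `s`: fixed `Ad(b^m)(D_τ) ≤ Π^tp_Ÿ`),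
  **`not_exists_package_modelχq_bTwist_of_constCompat`** (`p ≡ 1 (4)`, EVERY `s ∈ Ẑ`): for every theta-Kummer input
  `T` over `modelχq p 1 2` compatible with the genuine Kummer data `kummerDataχq p 1 2` and every `ι'` agreeing pointwise
  with `Ad(b^s) ∘ ι`, NO pull-back `ιFn` with `hιFn ∧ hΛ ∧ hιθ`; `exists_continuousMulEquiv_bTwist_inversionχq`.
CENSUS SENTENCE (model design, numbers not a side): the `b`-axis escape of abc-iut-w5-d125's memo (5) is CLOSED at the
Prop. 1.5 (iii)-carrying stage-2 model as well.

HONEST FRAMING: classical group theory over the cell's typed interface and its SEMI-SYNTHETIC Tate-sheared χ-model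
(consistency evidence only); nothing disputed is asserted; no side is taken on [IUTchIII] Cor 3.12; typed ≠ proved.
-/

noncomputable section

namespace Literature.AnabelianGeometry.EtaleTheta.SettingModel

open Literature.IUT.HodgeArakelov Literature.AnabelianGeometry.SemiGraphs
open Literature.AnabelianGeometry.AbsoluteAnabelian
open _root_.Topology _root_.Function

variable (p : ℕ) [Fact p.Prime]

/-! ### §0. Group-theoretic plumbing at the Tate instance -/

/-- `a·(b·x·b⁻¹)·a⁻¹ = (ab)·x·(ab)⁻¹`. [folklore] -/
private theorem conj_conj'' {G : Type*} [Group G] (a b x : G) : a * (b * x * b⁻¹) * a⁻¹ = a * b * x * (a * b)⁻¹ := by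
  group

/-- At the Tate pair `ι` is inversion on the `b`-axis: `ι(b^x) = b^{x⁻¹}` (no defect). [cite: MochizukiEtTh2009, §2 p.36] -/
theorem inversionχq_inl_bPowGfp_tate (x : ZH) :
    inversionχq p 1 2 (SemidirectProduct.inl (bPowGfp x)) = SemidirectProduct.inl (bPowGfp x⁻¹) := by
  refine SemidirectProduct.ext ?_ ?_
  · rw [inversionχq_left_tate, SemidirectProduct.left_inl, SemidirectProduct.left_inl, gfpInv_bPowGfp, ← map_inv]
  · rw [inversionχq_apply, tateInversion_right, SemidirectProduct.right_inl, SemidirectProduct.right_inl]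

/-- At the Tate pair `ι` fixes the complement: `ι(inr σ) = inr σ`. [cite: MochizukiEtTh2009, §2 p.36] -/
theorem inversionχq_inr_tate (σ : GQp p) :
    inversionχq p 1 2 (SemidirectProduct.inr σ) = SemidirectProduct.inr σ := by
  refine SemidirectProduct.ext ?_ ?_
  · rw [inversionχq_left_tate, SemidirectProduct.left_inr, map_one]
  · rw [inversionχq_apply, tateInversion_right]

/-- `ι` through a `b`-conjugation: `ι(b^m·x·b^{−m}) = b^{m⁻¹}·ι(x)·b^{−m⁻¹}`. [cite: MochizukiEtTh2009, §2 p.36] -/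
theorem inversionχq_conj_inl_bPowGfp_tate (m : ZH) (x : PiTpχq p 1 2) :
    inversionχq p 1 2 ((SemidirectProduct.inl (bPowGfp m) : PiTpχq p 1 2) * x * (SemidirectProduct.inl (bPowGfp m))⁻¹) =
      (SemidirectProduct.inl (bPowGfp m⁻¹) : PiTpχq p 1 2) * inversionχq p 1 2 x *
        (SemidirectProduct.inl (bPowGfp m⁻¹))⁻¹ := by
  rw [map_mul, map_mul, map_inv, inversionχq_inl_bPowGfp_tate]

/-- The augmentation kills `b`-conjugations. [cite: MochizukiEtTh2009, §1 p.12] -/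
theorem aug_modelχq_conj_inl_bPowGfp (m : ZH) (x : PiTpχq p 1 2) :
    (ThetaSetting.modelχq p 1 2 even_two).aug
        ((SemidirectProduct.inl (bPowGfp m) : PiTpχq p 1 2) * x * (SemidirectProduct.inl (bPowGfp m))⁻¹) =
      (ThetaSetting.modelχq p 1 2 even_two).aug x := by
  rw [map_mul, map_mul, map_inv]
  have h1 : (ThetaSetting.modelχq p 1 2 even_two).aug (SemidirectProduct.inl (bPowGfp m) : PiTpχq p 1 2) = 1 := rfl
  rw [h1, one_mul, inv_one, mul_one]

/-- The `b`-twisted lifts `Ad(b^s) ∘ ι` are topological automorphisms of `Π^tp_X` (non-vacuity of the `∀ ι'`).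
[cite: MochizukiEtTh2009, §2 p.36] -/
theorem exists_continuousMulEquiv_bTwist_inversionχq (s : ZH) :
    ∃ ι' : PiTpχq p 1 2 ≃ₜ* PiTpχq p 1 2, ∀ x,
      ι' x = (SemidirectProduct.inl (bPowGfp s) : PiTpχq p 1 2) * inversionχq p 1 2 x *
        (SemidirectProduct.inl (bPowGfp s))⁻¹ :=
  ⟨(inversionχq p 1 2).trans
    { toMulEquiv := MulAut.conj (SemidirectProduct.inl (bPowGfp s) : PiTpχq p 1 2)
      continuous_toFun := by
        change Continuous fun x : PiTpχq p 1 2 =>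
          (SemidirectProduct.inl (bPowGfp s) : PiTpχq p 1 2) * x * (SemidirectProduct.inl (bPowGfp s))⁻¹
        exact (continuous_const.mul continuous_id).mul continuous_const
      continuous_invFun := by
        change Continuous fun x : PiTpχq p 1 2 =>
          (SemidirectProduct.inl (bPowGfp s) : PiTpχq p 1 2)⁻¹ * x * SemidirectProduct.inl (bPowGfp s)
        exact (continuous_const.mul continuous_id).mul continuous_const }, fun _ => rfl⟩

/-! ### §1. The deck-corrected ODD lift fixes the stage-2 section of `τ` pointwise (`p ≡ 1 (mod 4)`) -/

/-- **The deck-corrected odd lift `Ad(b^{s₀}) ∘ ι` FIXES the stage-2 section of `τ` POINTWISE** (`p ≡ 1 (mod 4)`):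
an ODD `s₀ := t·(2c₀)⁻¹` from `ι(s_{√−1}) = Ad(b^{2c₀}) s_{(√−1)⁻¹}` (p448627) and the odd stage-2 deck identity
`Ad(b^t) s_{(√−1)⁻¹} = s_{√−1}` (p449236). [cite: MochizukiEtTh2009, Def 1.9 p.29] -/
theorem exists_odd_bTwist_inversionχq_fix_sectionOfUnitχq (hp : p % 4 = 1) :
    ∃ s₀ : ZH, ZHatLevel.level 2 s₀ ≠ 1 ∧ ∀ σ : GQp p,
      (SemidirectProduct.inl (bPowGfp s₀) : PiTpχq p 1 2) *
          inversionχq p 1 2 (sectionOfUnitχq p 1 2 even_two (sqrtNegOneUnitχ p hp) σ) *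
          (SemidirectProduct.inl (bPowGfp s₀))⁻¹ = sectionOfUnitχq p 1 2 even_two (sqrtNegOneUnitχ p hp) σ := by
  obtain ⟨c₀, hc₀⟩ := exists_inversionχq_sectionOfUnitχq_conj p hp
  obtain ⟨t, hodd, -, ht⟩ := exists_odd_deck_sectionOfUnitχq p hp
  refine ⟨t * (c₀ * c₀)⁻¹, ?_, fun σ => ?_⟩
  · have hsq : ∀ z : Multiplicative (ZMod ((2 : ℕ+) : ℕ)), (z * z)⁻¹ = 1 := by decide
    rw [map_mul, map_inv, map_mul, hsq, mul_one]
    exact hodd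
  · have key : (SemidirectProduct.inl (bPowGfp (t * (c₀ * c₀)⁻¹)) : PiTpχq p 1 2) *
        SemidirectProduct.inl (bPowGfp (c₀ * c₀)) = SemidirectProduct.inl (bPowGfp t) := by
      rw [← map_mul, ← map_mul, inv_mul_cancel_right]
    rw [hc₀ σ, conj_conj'', key, ht σ]

/-! ### §2. EVEN lifts: fixed `Ad(b^m)(inr G_K̈)` — NO package (all `p`) -/

/-- The Galois image of `Ad(b^m)(inr G_K̈) ≤ Π^tp_Ÿ` is `G_K̈`. [cite: MochizukiEtTh2009, §1 p.17] -/
theorem map_map_conj_inr_augTheta_kummerCoreχq (m : ZH) :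
    ((((ThetaSetting.modelχq p 1 2 even_two).GKdd.map
        (SemidirectProduct.inr : GQp p →* (ThetaSetting.modelχq p 1 2 even_two).PiTemp)).map
        (MulAut.conj (SemidirectProduct.inl (bPowGfp m) : PiTpχq p 1 2)).toMonoidHom).map
        (ThetaSetting.modelχq p 1 2 even_two).toTheta).map (kummerCoreχq p 1 2 even_two).augTheta =
      (ThetaSetting.modelχq p 1 2 even_two).Kdd.fixingSubgroup := by
  ext σ
  constructor
  · rintro ⟨_, ⟨_, ⟨_, ⟨σ', hσ', rfl⟩, rfl⟩, rfl⟩, rfl⟩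
    rw [MulEquiv.coe_toMonoidHom, MulAut.conj_apply, (kummerCoreχq p 1 2 even_two).augTheta_toTheta,
      aug_modelχq_conj_inl_bPowGfp]
    exact hσ'
  · intro hσ
    refine ⟨(ThetaSetting.modelχq p 1 2 even_two).toTheta ((SemidirectProduct.inl (bPowGfp m) : PiTpχq p 1 2) *
        SemidirectProduct.inr σ * (SemidirectProduct.inl (bPowGfp m))⁻¹),
      ⟨_, ⟨SemidirectProduct.inr σ, ⟨σ, hσ, rfl⟩, rfl⟩, rfl⟩, ?_⟩
    rw [(kummerCoreχq p 1 2 even_two).augTheta_toTheta, aug_modelχq_conj_inl_bPowGfp]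
    rfl

/-- **NO-GO for every EVEN `b`-axis lift at stage 2** (all `p`): for `s = m²`, any `ι'` agreeing pointwise with
`Ad(b^s) ∘ ι` fixes `Ad(b^m)(inr G_K̈) ≤ Π^tp_Ÿ` pointwise (Galois image `G_K̈`, `K̈ = ℚ_p` finite) ⇒ for every `T`
compatible with `kummerDataχq p 1 2` there is NO `ιFn` with `hιFn ∧ hΛ ∧ hιθ`. [cite: MochizukiEtTh2009, Prop 1.4 (ii) p.22] -/
theorem not_exists_package_modelχq_evenBTwist_of_constCompat
    (T : (ThetaSetting.modelχq p 1 2 even_two).ThetaKummerInput) (hcc : T.ConstCompat (kummerDataχq p 1 2 even_two))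
    {s : ZH} (hs : s ∈ sqHom.range) (ι' : PiTpχq p 1 2 ≃ₜ* PiTpχq p 1 2)
    (hι' : ∀ x, ι' x = (SemidirectProduct.inl (bPowGfp s) : PiTpχq p 1 2) * inversionχq p 1 2 x *
      (SemidirectProduct.inl (bPowGfp s))⁻¹) :
    ¬ ∃ ιFn : T.Fn →* T.Fn,
      (letI := T.instAction; ∀ (g : (ThetaSetting.modelχq p 1 2 even_two).PiTemp) (f : T.Fn),
        ιFn (g • f) = (ι' : (ThetaSetting.modelχq p 1 2 even_two).PiTemp ≃ₜ*
          (ThetaSetting.modelχq p 1 2 even_two).PiTemp) g • ιFn f) ∧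
      (∀ ζ : cyclotome T.Fn, cyclotome.map ιFn ζ = ζ) ∧ ιFn T.theta = T.const (-1) * T.theta := by
  obtain ⟨m, rfl⟩ := hs
  haveI := (ThetaSetting.modelχq p 1 2 even_two).compat.GtpYdd_normal
  haveI : FiniteDimensional ℚ_[p] (ThetaSetting.modelχq p 1 2 even_two).Kdd :=
    (kummerCoreχq p 1 2 even_two).finiteDimensional_Kdd
  have hle : (((ThetaSetting.modelχq p 1 2 even_two).GKdd.map
      (SemidirectProduct.inr : GQp p →* (ThetaSetting.modelχq p 1 2 even_two).PiTemp)).map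
      (MulAut.conj (SemidirectProduct.inl (bPowGfp m) : PiTpχq p 1 2)).toMonoidHom) ≤
        (ThetaSetting.modelχq p 1 2 even_two).GtpYdd := by
    rintro _ ⟨x, hx, rfl⟩
    rw [MulEquiv.coe_toMonoidHom, MulAut.conj_apply]
    exact Subgroup.Normal.conj_mem inferInstance _ (inr_map_GKdd_le_GtpYdd_tate p hx) _
  have hfix : ∀ g ∈ (((ThetaSetting.modelχq p 1 2 even_two).GKdd.map
      (SemidirectProduct.inr : GQp p →* (ThetaSetting.modelχq p 1 2 even_two).PiTemp)).map
      (MulAut.conj (SemidirectProduct.inl (bPowGfp m) : PiTpχq p 1 2)).toMonoidHom), ι' g = g := by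
    rintro _ ⟨_, ⟨σ, -, rfl⟩, rfl⟩
    rw [MulEquiv.coe_toMonoidHom, MulAut.conj_apply, hι', inversionχq_conj_inl_bPowGfp_tate, inversionχq_inr_tate,
      conj_conj'', ← map_mul, ← map_mul, sqHom_apply, pow_two, mul_inv_cancel_right]
  exact (kummerCoreχq p 1 2 even_two).not_exists_package_of_constCompat_of_fixed T hcc ι' hle hfix
    (ThetaSetting.modelχq p 1 2 even_two).Kdd (map_map_conj_inr_augTheta_kummerCoreχq p m)

/-! ### §3. ODD lifts: fixed `Ad(b^m)(D_τ)` — NO package (`p ≡ 1 (mod 4)`) -/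

/-- The Galois image of `Ad(b^m)(D_τ)`, `D_τ = s_{√−1}(G_K̈)`, is `G_K̈`. [cite: MochizukiEtTh2009, Def 1.9 p.29] -/
theorem map_map_conj_Dtau_augTheta_kummerCoreχq (hp : p % 4 = 1) (m : ZH) :
    ((((ThetaSetting.modelχq p 1 2 even_two).GKdd.map (sectionOfUnitχq p 1 2 even_two (sqrtNegOneUnitχ p hp))).map
        (MulAut.conj (SemidirectProduct.inl (bPowGfp m) : PiTpχq p 1 2)).toMonoidHom).map
        (ThetaSetting.modelχq p 1 2 even_two).toTheta).map (kummerCoreχq p 1 2 even_two).augTheta =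
      (ThetaSetting.modelχq p 1 2 even_two).Kdd.fixingSubgroup := by
  ext σ
  constructor
  · rintro ⟨_, ⟨_, ⟨_, ⟨σ', hσ', rfl⟩, rfl⟩, rfl⟩, rfl⟩
    rw [MulEquiv.coe_toMonoidHom, MulAut.conj_apply, (kummerCoreχq p 1 2 even_two).augTheta_toTheta,
      aug_modelχq_conj_inl_bPowGfp, aug_modelχq_sectionOfUnitχq]
    exact hσ'
  · intro hσ
    refine ⟨(ThetaSetting.modelχq p 1 2 even_two).toTheta ((SemidirectProduct.inl (bPowGfp m) : PiTpχq p 1 2) *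
        sectionOfUnitχq p 1 2 even_two (sqrtNegOneUnitχ p hp) σ * (SemidirectProduct.inl (bPowGfp m))⁻¹),
      ⟨_, ⟨sectionOfUnitχq p 1 2 even_two (sqrtNegOneUnitχ p hp) σ, ⟨σ, hσ, rfl⟩, rfl⟩, rfl⟩, ?_⟩
    rw [(kummerCoreχq p 1 2 even_two).augTheta_toTheta, aug_modelχq_conj_inl_bPowGfp, aug_modelχq_sectionOfUnitχq]

/-- **NO-GO for every ODD `b`-axis lift at stage 2** (`p ≡ 1 (mod 4)`): `s = m²·s₀` with `s₀` the `τ`-fixing exponent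
of §1, so `ι'` fixes `Ad(b^m)(D_τ) ≤ Π^tp_Ÿ` pointwise (Galois image `G_K̈`) and abc-iut-w5-d125's no-go applies.
[cite: MochizukiEtTh2009, Prop 1.4 (ii) p.22] -/
theorem not_exists_package_modelχq_oddBTwist_of_constCompat (hp : p % 4 = 1)
    (T : (ThetaSetting.modelχq p 1 2 even_two).ThetaKummerInput) (hcc : T.ConstCompat (kummerDataχq p 1 2 even_two))
    {s : ZH} (hs : ZHatLevel.level 2 s ≠ 1) (ι' : PiTpχq p 1 2 ≃ₜ* PiTpχq p 1 2)
    (hι' : ∀ x, ι' x = (SemidirectProduct.inl (bPowGfp s) : PiTpχq p 1 2) * inversionχq p 1 2 x *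
      (SemidirectProduct.inl (bPowGfp s))⁻¹) :
    ¬ ∃ ιFn : T.Fn →* T.Fn,
      (letI := T.instAction; ∀ (g : (ThetaSetting.modelχq p 1 2 even_two).PiTemp) (f : T.Fn),
        ιFn (g • f) = (ι' : (ThetaSetting.modelχq p 1 2 even_two).PiTemp ≃ₜ*
          (ThetaSetting.modelχq p 1 2 even_two).PiTemp) g • ιFn f) ∧
      (∀ ζ : cyclotome T.Fn, cyclotome.map ιFn ζ = ζ) ∧ ιFn T.theta = T.const (-1) * T.theta := by
  obtain ⟨s₀, hs₀, hfix₀⟩ := exists_odd_bTwist_inversionχq_fix_sectionOfUnitχq p hp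
  obtain ⟨m, hm⟩ := mul_inv_mem_range_sqHom_of_odd hs hs₀
  rw [sqHom_apply] at hm
  have hsm : s * m⁻¹ = m * s₀ := by
    have h1 : s = m ^ 2 * s₀ := by rw [hm, inv_mul_cancel_right]
    rw [h1, pow_two, mul_assoc, mul_assoc, ZHatCompletion.mul_comm s₀, mul_inv_cancel_left]
  haveI := (ThetaSetting.modelχq p 1 2 even_two).compat.GtpYdd_normal
  haveI : FiniteDimensional ℚ_[p] (ThetaSetting.modelχq p 1 2 even_two).Kdd :=
    (kummerCoreχq p 1 2 even_two).finiteDimensional_Kdd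
  have hle : (((ThetaSetting.modelχq p 1 2 even_two).GKdd.map
      (sectionOfUnitχq p 1 2 even_two (sqrtNegOneUnitχ p hp))).map
      (MulAut.conj (SemidirectProduct.inl (bPowGfp m) : PiTpχq p 1 2)).toMonoidHom) ≤
        (ThetaSetting.modelχq p 1 2 even_two).GtpYdd := by
    rintro _ ⟨x, hx, rfl⟩
    rw [MulEquiv.coe_toMonoidHom, MulAut.conj_apply]
    exact Subgroup.Normal.conj_mem inferInstance _ (map_sectionOfUnitχq_GKdd_le_GtpYdd p 1 2 even_two _ hx) _
  have hfix : ∀ g ∈ (((ThetaSetting.modelχq p 1 2 even_two).GKdd.map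
      (sectionOfUnitχq p 1 2 even_two (sqrtNegOneUnitχ p hp))).map
      (MulAut.conj (SemidirectProduct.inl (bPowGfp m) : PiTpχq p 1 2)).toMonoidHom), ι' g = g := by
    rintro _ ⟨_, ⟨σ, -, rfl⟩, rfl⟩
    have key : (SemidirectProduct.inl (bPowGfp s) : PiTpχq p 1 2) * SemidirectProduct.inl (bPowGfp m⁻¹) =
        SemidirectProduct.inl (bPowGfp m) * SemidirectProduct.inl (bPowGfp s₀) := by
      rw [← map_mul, ← map_mul, ← map_mul, ← map_mul, hsm]
    rw [MulEquiv.coe_toMonoidHom, MulAut.conj_apply, hι', inversionχq_conj_inl_bPowGfp_tate, conj_conj'', key,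
      ← conj_conj'', hfix₀ σ]
  exact (kummerCoreχq p 1 2 even_two).not_exists_package_of_constCompat_of_fixed T hcc ι' hle hfix
    (ThetaSetting.modelχq p 1 2 even_two).Kdd (map_map_conj_Dtau_augTheta_kummerCoreχq p hp m)

/-! ### §4. Every `b`-axis lift at stage 2 (`p ≡ 1 (mod 4)`) -/

/-- **NO `b`-AXIS LIFT OF THE STAGE-2 INVERSION CARRIES THE FUNCTION-LEVEL PACKAGE** (`p ≡ 1 (mod 4)`, every
`s ∈ Ẑ`) at the Prop. 1.5 (iii)-carrying Tate instance `modelχq p 1 2`. [cite: MochizukiEtTh2009, Prop 1.4 (ii) p.22] -/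
theorem not_exists_package_modelχq_bTwist_of_constCompat (hp : p % 4 = 1)
    (T : (ThetaSetting.modelχq p 1 2 even_two).ThetaKummerInput) (hcc : T.ConstCompat (kummerDataχq p 1 2 even_two))
    (s : ZH) (ι' : PiTpχq p 1 2 ≃ₜ* PiTpχq p 1 2)
    (hι' : ∀ x, ι' x = (SemidirectProduct.inl (bPowGfp s) : PiTpχq p 1 2) * inversionχq p 1 2 x *
      (SemidirectProduct.inl (bPowGfp s))⁻¹) :
    ¬ ∃ ιFn : T.Fn →* T.Fn,
      (letI := T.instAction; ∀ (g : (ThetaSetting.modelχq p 1 2 even_two).PiTemp) (f : T.Fn),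
        ιFn (g • f) = (ι' : (ThetaSetting.modelχq p 1 2 even_two).PiTemp ≃ₜ*
          (ThetaSetting.modelχq p 1 2 even_two).PiTemp) g • ιFn f) ∧
      (∀ ζ : cyclotome T.Fn, cyclotome.map ιFn ζ = ζ) ∧ ιFn T.theta = T.const (-1) * T.theta := by
  by_cases hs : ZHatLevel.level 2 s = 1
  · exact not_exists_package_modelχq_evenBTwist_of_constCompat p T hcc
      ((mem_range_sqHom_iff s).mpr (by rw [modN_eq_level]; exact hs)) ι' hι'
  · exact not_exists_package_modelχq_oddBTwist_of_constCompat p hp T hcc hs ι' hι'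

end Literature.AnabelianGeometry.EtaleTheta.SettingModel

end
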